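import Summits.Ventures.QEC.Thresholds.ToricCodeHGPThresholds
import Summits.Ventures.QEC.Thresholds.PlanarDepolarizingThreshold
import Summits.Ventures.QEC.Census.BB.BB72Rank
import Summits.Ventures.QEC.Census.BB.BB144Rank
import Literature.InformationTheory.QuantumCodes.CSSThresholdConverses
import Literature.InformationTheory.QuantumCodes.CSSEquivalenceNoise
import HarnessLib

/-!
# Certified threshold CEILINGS for the census families: `y₀^Z + y₀^X ≤ 1`, `p₀^Z + p₀^X ≤ 1/2` (every
# decoder); toric codes `y_c ≤ 1/2`, `p_c ≤ 1/4`; finite-size floors for `[[72,12,6]]` and `[[144,12,12]]`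

Venture QEC, `Summits/Ventures/QEC/Thresholds/` (LADDER-QEC rung Q5; qec-lit-2 gen 4). HONEST FRAMING. Every
threshold theorem of the cell so far is a certified LOWER bound (`IsThresholdLowerBound … p₀`: failure
probability `→ 0` for every rate below `p₀`). This file is the other column: certified UPPER bounds, i.e.
theorems `IsThresholdLowerBound … a → a ≤ c`, equivalently `accuracyThreshold … ≤ c`, valid for EVERY decoder
(maximum likelihood included) — the packaging over the census families of `CSSFamilyThresholds.lean`
(`zErasureFamily`, `xErasureFamily`, `zFailureFamily`, `xFailureFamily`: they are DEFINITIONALLY the families of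
the Literature theorems) of `Literature/…/CSSThresholdConverses.lean`:

* for EVERY family of CSS codes with `k ≥ 1`: the two sectors' erasure threshold lower bounds sum to `≤ 1`
  (`erasureThreshold_sum_le_one`, `erasureAccuracyThreshold_sum_le_one`) and, for ANY decoder families, the two
  sectors' code-capacity threshold lower bounds sum to `≤ 1/2` (`capacityThreshold_sum_le_half`,
  `capacityAccuracyThreshold_sum_le_half`) — mechanisms: the CSS Cleaning Lemma / no-cloning dichotomy and the
  erasure decomposition `BSC(p) ≼ BEC(2p)`, both PROVED in the Literature file;
* **toric codes** `HGP(circ_L, circ_L)` (`toricHGPCode`, both sectors): the `X ↔ Z` exchange is a RE-INDEXING of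
  the code (swap the two coordinates of every qubit and check: `toricHGPCode_swap_eq_reindex`), so by
  `CSSEquivalenceNoise.lean` the two sectors have identical erasure families (`toricHGP_xErasureFamily_eq`) and
  every `Z`-decoder transports to an `X`-decoder with the same failure probability; hence
  **`1/3 ≤ y_c ≤ 1/2`** for the erasure accuracy threshold of EITHER sector (`toricHGP_z_erasure_accuracyThreshold_mem`,
  `…_x_…`; the printed value is `0.5`, Stace–Barrett–Doherty 2009, by bond percolation — NOT proved) and
  **`p_c ≤ 1/4` for EVERY decoder family** (`toricHGP_z_capacity_threshold_le_quarter`; with the floor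
  `p₀(3) ≈ .0286` for minimum-weight decoders: `toricHGP_z_capacity_accuracyThreshold_mem`; numerics put the
  optimal-decoder value near `.109` and MWPM near `.103` — VALIDATED-column numbers, not theorems);
* planar surface codes: `y_c^Z + y_c^X ≤ 1` and `p₀^Z + p₀^X ≤ 1/2` (sum forms; their sector symmetry is a
  reflection of the lattice, not typed here);
* finite size, EVERY decoder: for `BB.bb72` (`[[72,12,6]]`) and `BB.bb144` (`[[144,12,12]]`),
  `1 ≤ P^Z_y[erasure uncorrectable] + P^X_{1-y}[erasure uncorrectable]` and
  `1/2 ≤ P^Z_p[D_Z fails] + P^X_{1/2-p}[D_X fails]` (`bb72_one_le_uncorrectableProb_add`, …) — the floors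
  complementing the certified finite-size ceilings of `BBFiniteSizeBounds.lean` / `BB144FiniteSizeBounds.lean`.

Kernel axioms only; no named fact; no `native_decide`; no new definition.

## References

* [BravyiTerhal2009] S. Bravyi, B. Terhal, New J. Phys. 11 (2009) 043029, §2 Lemma 1 (Cleaning Lemma).
* [StaceBarrettDoherty2009] T. M. Stace, S. D. Barrett, A. C. Doherty, PRL 102 (2009) 200501, p. 1–2 («maximum
  tolerable loss rate is 50% … saturates the bound set by the no-cloning theorem»).
* [RichardsonUrbanke2008] T. Richardson, R. Urbanke, *Modern Coding Theory*, Lemma 4.78 (Erasure Decomposition).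
* [KovalevPryadko2012] A. A. Kovalev, L. P. Pryadko, ISIT 2012, Examples 2 and 6 (toric codes as hypergraph
  products of circulant matrices).
* [BravyiEtAl2024] S. Bravyi et al., Nature 627 (2024) 778, Table 1 (`[[72,12,6]]`, `[[144,12,12]]`).
-/

noncomputable section

namespace Summit.Ventures.QEC.Thresholds

open Filter Topology Finset Matrix
open Literature.InformationTheory.QuantumCodes

/-! ### Every census family: the two sectors' certified thresholds sum to at most `1` (erasures) / `1/2` (flips) -/

section Families

variable {RX RZ Q : ℕ → Type*} [∀ i, Fintype (Q i)] [∀ i, DecidableEq (Q i)] [∀ i, Fintype (RX i)]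
  [∀ i, Fintype (RZ i)]

/-- **Erasure ceilings, census form**: for a family of CSS codes with `k ≥ 1`, any certified erasure threshold
lower bounds `a` (for `zErasureFamily`) and `b` (for `xErasureFamily`) satisfy `a + b ≤ 1`.
[cite: StaceBarrettDoherty2009, p. 2 (no-cloning bound on p_loss); BravyiTerhal2009, §2 Lemma 1] -/
theorem erasureThreshold_sum_le_one (C : ∀ i, CSSCode (RX i) (RZ i) (Q i)) (hk : ∀ i, 0 < (C i).k) {a b : ℝ}
    (ha : IsThresholdLowerBound (zErasureFamily C) a) (hb : IsThresholdLowerBound (xErasureFamily C) b) :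
    a + b ≤ 1 :=
  erasure_thresholds_add_le_one C hk ha hb

/-- **`y_c^Z + y_c^X ≤ 1`** for the erasure accuracy thresholds of the two sectors of any census family with
`k ≥ 1`. [cite: StaceBarrettDoherty2009, p. 2 (no-cloning bound on p_loss)] -/
theorem erasureAccuracyThreshold_sum_le_one (C : ∀ i, CSSCode (RX i) (RZ i) (Q i)) (hk : ∀ i, 0 < (C i).k) :
    accuracyThreshold (zErasureFamily C) + accuracyThreshold (xErasureFamily C) ≤ 1 :=
  erasure_accuracyThresholds_add_le_one C hk

/-- **Code-capacity ceilings, census form**: for a family of CSS codes with `k ≥ 1` and ANY decoder families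
`DZ`, `DX`, certified threshold lower bounds `a` (for `zFailureFamily C DZ`) and `b` (for `xFailureFamily C DX`)
satisfy `a + b ≤ 1/2`. [cite: RichardsonUrbanke2008, Lemma 4.78 (Erasure Decomposition Lemma); StaceBarrettDoherty2009, p. 2] -/
theorem capacityThreshold_sum_le_half (C : ∀ i, CSSCode (RX i) (RZ i) (Q i)) (hk : ∀ i, 0 < (C i).k)
    (DZ : ∀ i, Decoder (RX i → ZMod 2) (Q i → ZMod 2)) (DX : ∀ i, Decoder (RZ i → ZMod 2) (Q i → ZMod 2))
    {a b : ℝ} (ha : IsThresholdLowerBound (zFailureFamily C DZ) a)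
    (hb : IsThresholdLowerBound (xFailureFamily C DX) b) : a + b ≤ 1 / 2 :=
  capacity_thresholds_add_le_half C hk DZ DX ha hb

/-- **`p_c^Z + p_c^X ≤ 1/2`** for the code-capacity accuracy thresholds of the two sectors, ANY decoder
families. [cite: RichardsonUrbanke2008, Lemma 4.78 (Erasure Decomposition Lemma)] -/
theorem capacityAccuracyThreshold_sum_le_half (C : ∀ i, CSSCode (RX i) (RZ i) (Q i)) (hk : ∀ i, 0 < (C i).k)
    (DZ : ∀ i, Decoder (RX i → ZMod 2) (Q i → ZMod 2)) (DX : ∀ i, Decoder (RZ i → ZMod 2) (Q i → ZMod 2)) :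
    accuracyThreshold (zFailureFamily C DZ) + accuracyThreshold (xFailureFamily C DX) ≤ 1 / 2 :=
  capacity_accuracyThresholds_add_le_half C hk DZ DX

/-- Single-sector form: no code-capacity threshold lower bound exceeds `1/2`, whatever the decoders.
[cite: RichardsonUrbanke2008, Lemma 4.78 (Erasure Decomposition Lemma)] -/
theorem capacityThreshold_le_half (C : ∀ i, CSSCode (RX i) (RZ i) (Q i)) (hk : ∀ i, 0 < (C i).k)
    (DZ : ∀ i, Decoder (RX i → ZMod 2) (Q i → ZMod 2)) {a : ℝ}
    (ha : IsThresholdLowerBound (zFailureFamily C DZ) a) : a ≤ 1 / 2 :=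
  capacity_threshold_le_half C hk DZ ha

/-- Single-sector form: no erasure threshold lower bound exceeds `1`. [cite: StaceBarrettDoherty2009, p. 2] -/
theorem erasureThreshold_le_one (C : ∀ i, CSSCode (RX i) (RZ i) (Q i)) (hk : ∀ i, 0 < (C i).k) {a : ℝ}
    (ha : IsThresholdLowerBound (zErasureFamily C) a) : a ≤ 1 :=
  erasure_threshold_le_one C hk ha

end Families

/-! ### Toric codes: the `X ↔ Z` exchange is a re-indexing; `y_c ≤ 1/2`, `p_c ≤ 1/4` -/

section Toric

/- Notation used below (inlined, no definitions): the coordinate swap of the torus sites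
`σ_L := Equiv.prodComm (Fin L) (Fin L)` (`(a, b) ↦ (b, a)`; the same type indexes the `X`-checks, the `Z`-checks
and each qubit block of `HGP(circ_L, circ_L)`) and the induced qubit permutation `Equiv.sumCongr σ_L σ_L`. -/

/-- **`H^Z` of the toric code is `H^X` with coordinates swapped**: `H^Z (i,j) q = H^X (j,i) (swap q)` for
`HGP(circ_L, circ_L)` (`[1 ⊗ C | Cᵀ ⊗ 1]` versus `[C ⊗ 1 | 1 ⊗ Cᵀ]`).
[cite: KovalevPryadko2012, Example 6 (toric codes as hypergraph products of circulant matrices)] -/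
theorem toricHGPCode_HZ_eq_submatrix (k : ℕ) :
    (toricHGPCode k).HZ = (toricHGPCode k).HX.submatrix (Equiv.prodComm (Fin (k + 2)) (Fin (k + 2)))
      (Equiv.sumCongr (Equiv.prodComm (Fin (k + 2)) (Fin (k + 2))) (Equiv.prodComm (Fin (k + 2)) (Fin (k + 2)))) := by
  ext ⟨i, j⟩ q
  rcases q with ⟨a, b⟩ | ⟨c, d⟩
  · simp [HGP.code_HX, HGP.code_HZ, HGP.HX_eq, HGP.HZ_eq, Matrix.fromCols_apply_inl, Matrix.kroneckerMap_apply,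
      Matrix.one_apply, mul_comm]
  · simp [HGP.code_HX, HGP.code_HZ, HGP.HX_eq, HGP.HZ_eq, Matrix.fromCols_apply_inr, Matrix.kroneckerMap_apply,
      Matrix.one_apply, Matrix.transpose_apply, mul_comm]

/-- And symmetrically `H^X (i,j) q = H^Z (j,i) (swap q)`. [cite: KovalevPryadko2012, Example 6] -/
theorem toricHGPCode_HX_eq_submatrix (k : ℕ) :
    (toricHGPCode k).HX = (toricHGPCode k).HZ.submatrix (Equiv.prodComm (Fin (k + 2)) (Fin (k + 2)))
      (Equiv.sumCongr (Equiv.prodComm (Fin (k + 2)) (Fin (k + 2))) (Equiv.prodComm (Fin (k + 2)) (Fin (k + 2)))) := by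
  ext ⟨i, j⟩ q
  rcases q with ⟨a, b⟩ | ⟨c, d⟩
  · simp [HGP.code_HX, HGP.code_HZ, HGP.HX_eq, HGP.HZ_eq, Matrix.fromCols_apply_inl, Matrix.kroneckerMap_apply,
      Matrix.one_apply, mul_comm]
  · simp [HGP.code_HX, HGP.code_HZ, HGP.HX_eq, HGP.HZ_eq, Matrix.fromCols_apply_inr, Matrix.kroneckerMap_apply,
      Matrix.one_apply, Matrix.transpose_apply, mul_comm]

/-- **The `X ↔ Z` exchange of the toric code is a re-indexing of the toric code** (coordinate swap of checks
and qubits). [cite: KovalevPryadko2012, Example 6 (toric codes as hypergraph products)] -/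
theorem toricHGPCode_swap_eq_reindex (k : ℕ) :
    (toricHGPCode k).swap =
      (toricHGPCode k).reindex (Equiv.prodComm (Fin (k + 2)) (Fin (k + 2))).symm
        (Equiv.prodComm (Fin (k + 2)) (Fin (k + 2))).symm
        (Equiv.sumCongr (Equiv.prodComm (Fin (k + 2)) (Fin (k + 2)))
          (Equiv.prodComm (Fin (k + 2)) (Fin (k + 2)))).symm :=
  CSSCode.eq_reindex_of_submatrix (C := toricHGPCode k) (C' := (toricHGPCode k).swap)
    (toricHGPCode_HZ_eq_submatrix k) (toricHGPCode_HX_eq_submatrix k)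

/-- **The two sectors of the toric code have the same erasure family**: `P^X_y[uncorrectable] =
P^Z_y[uncorrectable]` for every `L` and `y`.
[cite: StaceBarrettDoherty2009, p. 2 (losses affect X̄ and Z̄ symmetrically on the torus)] -/
theorem toricHGP_xErasureFamily_eq (k : ℕ) (y : ℝ) :
    xErasureFamily (fun k => toricHGPCode k) k y = zErasureFamily (fun k => toricHGPCode k) k y := by
  rw [xErasureFamily_eq_swap]
  change ErasureDecoder.uncorrectableProb {x | (toricHGPCode k).swap.HX *ᵥ x = 0}
      ((toricHGPCode k).swap.rowSpZ : Set _) y =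
    ErasureDecoder.uncorrectableProb {x | (toricHGPCode k).HX *ᵥ x = 0} ((toricHGPCode k).rowSpZ : Set _) y
  rw [toricHGPCode_swap_eq_reindex, CSSCode.uncorrectableProb_reindex]

/-- Family form: `xErasureFamily = zErasureFamily` for the toric codes. [cite: StaceBarrettDoherty2009, p. 2] -/
theorem toricHGP_xErasureFamily_eq_zErasureFamily :
    xErasureFamily (fun k => toricHGPCode k) = zErasureFamily (fun k => toricHGPCode k) := by
  funext k y
  exact toricHGP_xErasureFamily_eq k y

/-- `k = 2 > 0` for every member (non-vacuity of the converses). [cite: KovalevPryadko2012, Example 6 ([[2d², 2, d]])] -/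
theorem toricHGPCode_k_pos (k : ℕ) : 0 < (toricHGPCode k).k := by
  rw [toricHGPCode_k]
  norm_num

/-- **Toric erasure threshold `≤ 1/2`, `Z`-sector**: no number above `1/2` can ever be certified as an erasure
threshold lower bound of the toric codes («the maximum tolerable loss rate is 50% … This saturates the bound set
by the no-cloning theorem»; the tree's certified floor is `1/3`). [cite: StaceBarrettDoherty2009, p. 1 (abstract) and p. 2] -/
theorem toricHGP_z_erasure_threshold_le_half {a : ℝ}
    (ha : IsThresholdLowerBound (zErasureFamily (fun k => toricHGPCode k)) a) : a ≤ 1 / 2 :=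
  erasure_threshold_le_half_of_symm (fun k => toricHGPCode k) toricHGPCode_k_pos
    (fun k y => toricHGP_xErasureFamily_eq k y) ha

/-- **Toric erasure threshold `≤ 1/2`, `X`-sector.** [cite: StaceBarrettDoherty2009, p. 1 (abstract) and p. 2] -/
theorem toricHGP_x_erasure_threshold_le_half {a : ℝ}
    (ha : IsThresholdLowerBound (xErasureFamily (fun k => toricHGPCode k)) a) : a ≤ 1 / 2 := by
  rw [toricHGP_xErasureFamily_eq_zErasureFamily] at ha
  exact toricHGP_z_erasure_threshold_le_half ha

/-- **`1/3 ≤ y_c ≤ 1/2` for the toric codes' erasure accuracy threshold (`Z`-sector)** — a certified two-sided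
interval (floor: Dumer–Kovalev–Pryadko `1/(w-1)`; ceiling: no-cloning; printed value `0.5` by bond percolation,
NOT proved). [cite: StaceBarrettDoherty2009, p. 2 (p_loss < 0.5); DumerKovalevPryadko2015, p. 5 (y_c* = 1/3)] -/
theorem toricHGP_z_erasure_accuracyThreshold_mem :
    (1 / 3 : ℝ) ≤ accuracyThreshold (zErasureFamily (fun k => toricHGPCode k)) ∧
      accuracyThreshold (zErasureFamily (fun k => toricHGPCode k)) ≤ 1 / 2 :=
  ⟨le_accuracyThreshold toricHGP_z_erasure_isThresholdLowerBound (by norm_num),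
    toricHGP_z_erasure_threshold_le_half (isThresholdLowerBound_accuracyThreshold _)⟩

/-- **`1/3 ≤ y_c ≤ 1/2`, `X`-sector.**
[cite: StaceBarrettDoherty2009, p. 2 (p_loss < 0.5); DumerKovalevPryadko2015, p. 5 (y_c* = 1/3)] -/
theorem toricHGP_x_erasure_accuracyThreshold_mem :
    (1 / 3 : ℝ) ≤ accuracyThreshold (xErasureFamily (fun k => toricHGPCode k)) ∧
      accuracyThreshold (xErasureFamily (fun k => toricHGPCode k)) ≤ 1 / 2 :=
  ⟨le_accuracyThreshold toricHGP_x_erasure_isThresholdLowerBound (by norm_num),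
    toricHGP_x_erasure_threshold_le_half (isThresholdLowerBound_accuracyThreshold _)⟩

open Classical in
/-- **The transported decoder has the same failure probability**: every `Z`-decoder family `DZ` of the toric
codes yields an `X`-decoder family (`s ↦ DZ(s ∘ swap) ∘ swap`) whose `X`-sector failure family equals the
`Z`-sector failure family of `DZ`. [cite: StaceBarrettDoherty2009, p. 2 (X̄ and Z̄ enter symmetrically)] -/
theorem toricHGP_xFailureFamily_transport_eq
    (DZ : ∀ k, Decoder ((Fin (k + 2) × Fin (k + 2)) → ZMod 2)
      (((Fin (k + 2) × Fin (k + 2)) ⊕ (Fin (k + 2) × Fin (k + 2))) → ZMod 2)) :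
    xFailureFamily (fun k => toricHGPCode k)
        (fun k => fun s' => DZ k (s' ∘ (Equiv.prodComm (Fin (k + 2)) (Fin (k + 2))).symm) ∘
          (Equiv.sumCongr (Equiv.prodComm (Fin (k + 2)) (Fin (k + 2)))
            (Equiv.prodComm (Fin (k + 2)) (Fin (k + 2)))).symm.symm) =
      zFailureFamily (fun k => toricHGPCode k) DZ := by
  funext k p
  rw [xFailureFamily_eq_swap]
  change (∑ e ∈ univ.filter (fun e => ¬ Decoder.Corrects
        (fun s' => DZ k (s' ∘ (Equiv.prodComm (Fin (k + 2)) (Fin (k + 2))).symm) ∘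
          (Equiv.sumCongr (Equiv.prodComm (Fin (k + 2)) (Fin (k + 2)))
            (Equiv.prodComm (Fin (k + 2)) (Fin (k + 2)))).symm.symm) (toricHGPCode k).swap.zSyndrome
        ((toricHGPCode k).swap.rowSpZ : Set _) e), bernoulliWeight p (supp e)) =
    ∑ e ∈ univ.filter (fun e => ¬ (DZ k).Corrects (toricHGPCode k).zSyndrome
        ((toricHGPCode k).rowSpZ : Set _) e), bernoulliWeight p (supp e)
  rw [toricHGPCode_swap_eq_reindex]
  exact CSSCode.zFailure_reindex (toricHGPCode k) (Equiv.prodComm (Fin (k + 2)) (Fin (k + 2))).symm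
    (Equiv.prodComm (Fin (k + 2)) (Fin (k + 2))).symm
    (Equiv.sumCongr (Equiv.prodComm (Fin (k + 2)) (Fin (k + 2)))
      (Equiv.prodComm (Fin (k + 2)) (Fin (k + 2)))).symm (DZ k) p

open Classical in
/-- **Toric code-capacity threshold `≤ 1/4` for EVERY decoder family** (`Z`-sector, independent phase flips;
maximum likelihood included): flips at rate `p` are erasures at rate `2p` plus fair coins, and the two (symmetric)
sectors' erasure thresholds sum to `≤ 1`. Numerics put the optimal decoder near `.109` (VALIDATED column).
[cite: RichardsonUrbanke2008, Lemma 4.78 (Erasure Decomposition Lemma); StaceBarrettDoherty2009, p. 2] -/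
theorem toricHGP_z_capacity_threshold_le_quarter
    (DZ : ∀ k, Decoder ((Fin (k + 2) × Fin (k + 2)) → ZMod 2)
      (((Fin (k + 2) × Fin (k + 2)) ⊕ (Fin (k + 2) × Fin (k + 2))) → ZMod 2))
    {a : ℝ} (ha : IsThresholdLowerBound (zFailureFamily (fun k => toricHGPCode k) DZ) a) : a ≤ 1 / 4 := by
  have hb : IsThresholdLowerBound (xFailureFamily (fun k => toricHGPCode k)
      (fun k => fun s' => DZ k (s' ∘ (Equiv.prodComm (Fin (k + 2)) (Fin (k + 2))).symm) ∘
          (Equiv.sumCongr (Equiv.prodComm (Fin (k + 2)) (Fin (k + 2)))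
            (Equiv.prodComm (Fin (k + 2)) (Fin (k + 2)))).symm.symm)) a := by
    rw [toricHGP_xFailureFamily_transport_eq]
    exact ha
  have h := capacity_thresholds_add_le_half (fun k => toricHGPCode k) toricHGPCode_k_pos DZ _ ha hb
  linarith

open Classical in
/-- **`p₀(3) ≤ p_c ≤ 1/4`** for the toric codes' code-capacity accuracy threshold under any family of
minimum-weight `Z`-decoders — a certified two-sided interval (`p₀(3) = (3-2√2)/6 ≈ .0286`).
[cite: DumerKovalevPryadko2015, p. 5 (p_Zc* ≈ 0.029); RichardsonUrbanke2008, Lemma 4.78] -/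
theorem toricHGP_z_capacity_accuracyThreshold_mem
    (D : ∀ k, Decoder ((Fin (k + 2) × Fin (k + 2)) → ZMod 2)
      (((Fin (k + 2) × Fin (k + 2)) ⊕ (Fin (k + 2) × Fin (k + 2))) → ZMod 2))
    (hD : ∀ k, (D k).IsMinWeight (toricHGPCode k).zSyndrome ((toricHGPCode k).kerX : Set _) hammingNorm) :
    thresholdValue 3 ≤ accuracyThreshold (zFailureFamily (fun k => toricHGPCode k) D) ∧
      accuracyThreshold (zFailureFamily (fun k => toricHGPCode k) D) ≤ 1 / 4 :=
  ⟨le_accuracyThreshold (toricHGP_z_isThresholdLowerBound D hD) ((thresholdValue_le_half 3).trans (by norm_num)),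
    toricHGP_z_capacity_threshold_le_quarter D (isThresholdLowerBound_accuracyThreshold _)⟩

open Classical in
/-- **`p_c ≤ 1/4` for EVERY decoder family, accuracy-threshold form** (`Z`-sector of the toric codes).
[cite: RichardsonUrbanke2008, Lemma 4.78 (Erasure Decomposition Lemma)] -/
theorem toricHGP_z_capacity_accuracyThreshold_le_quarter
    (DZ : ∀ k, Decoder ((Fin (k + 2) × Fin (k + 2)) → ZMod 2)
      (((Fin (k + 2) × Fin (k + 2)) ⊕ (Fin (k + 2) × Fin (k + 2))) → ZMod 2)) :
    accuracyThreshold (zFailureFamily (fun k => toricHGPCode k) DZ) ≤ 1 / 4 :=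
  toricHGP_z_capacity_threshold_le_quarter DZ (isThresholdLowerBound_accuracyThreshold _)

end Toric

/-! ### Planar surface codes: sum forms -/

section Planar

/-- `k = 1 > 0` for every planar surface code. [cite: TillichZemor2014, Thm 7] -/
theorem planarHGPCode_k_pos (k : ℕ) : 0 < (planarHGPCode k).k := by
  rw [planarHGPCode_k]
  norm_num

/-- The census erasure families of the planar codes ARE lit-2's `planarErasureFamily` / `planarErasureFamily'`
(definitional). [cite: DumerKovalevPryadko2015, Thm 2 (erasure part)] -/
theorem zErasureFamily_planarHGPCode : zErasureFamily (fun k => planarHGPCode k) = planarErasureFamily := rfl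

/-- Second sector (definitional). [cite: DumerKovalevPryadko2015, Thm 2 (erasure part)] -/
theorem xErasureFamily_planarHGPCode : xErasureFamily (fun k => planarHGPCode k) = planarErasureFamily' := rfl

/-- **Planar surface codes: `y₀ + y₀' ≤ 1`** for any certified erasure threshold lower bounds of the two
sectors (floors `1/3` each are in `PlanarSurfaceCodeThresholds.lean`).
[cite: StaceBarrettDoherty2009, p. 2 (no-cloning bound on p_loss)] -/
theorem planar_erasureThreshold_sum_le_one {a b : ℝ} (ha : IsThresholdLowerBound planarErasureFamily a)
    (hb : IsThresholdLowerBound planarErasureFamily' b) : a + b ≤ 1 :=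
  erasureThreshold_sum_le_one (fun k => planarHGPCode k) planarHGPCode_k_pos ha hb

/-- **Planar surface codes: `p₀ + p₀' ≤ 1/2`** for any certified code-capacity threshold lower bounds of the two
sectors, ANY decoder families (floors `p₀(3)` for minimum-weight decoders are in `PlanarSurfaceCodeThresholds.lean`).
[cite: RichardsonUrbanke2008, Lemma 4.78 (Erasure Decomposition Lemma)] -/
theorem planar_capacityThreshold_sum_le_half
    (DZ : ∀ k, Decoder (PlanarCheck k → ZMod 2) (PlanarQubit k → ZMod 2))
    (DX : ∀ k, Decoder (PlanarZCheck k → ZMod 2) (PlanarQubit k → ZMod 2)) {a b : ℝ}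
    (ha : IsThresholdLowerBound (planarFailureFamily DZ) a) (hb : IsThresholdLowerBound (planarFailureFamily' DX) b) :
    a + b ≤ 1 / 2 :=
  capacityThreshold_sum_le_half (fun k => planarHGPCode k) planarHGPCode_k_pos DZ DX ha hb

end Planar

/-! ### Finite size: the flagship bivariate-bicycle codes, every decoder -/

section BB

/-- `k = 12 > 0` for `[[72,12,6]]` (kernel rank certificate). [cite: BravyiEtAl2024, Table 1 row [[72,12,6]]] -/
theorem bb72_css_k_pos : 0 < BB.bb72.css.k := by
  change 0 < BB.bb72.k
  rw [Census.bb72_k]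
  norm_num

/-- `k = 12 > 0` for `[[144,12,12]]` (kernel rank certificate). [cite: BravyiEtAl2024, Table 1 row [[144,12,12]]] -/
theorem bb144_css_k_pos : 0 < BB.bb144.css.k := by
  change 0 < BB.bb144.k
  rw [Census.bb144_k]
  norm_num

/-- **`[[72,12,6]]`, erasures, floor**: for every `0 ≤ y ≤ 1`,
`1 ≤ P^Z_y[erasure uncorrectable] + P^X_{1-y}[erasure uncorrectable]`.
[cite: StaceBarrettDoherty2009, p. 2 (no-cloning bound); BravyiTerhal2009, §2 Lemma 1] -/
theorem bb72_one_le_uncorrectableProb_add {y : ℝ} (hy0 : 0 ≤ y) (hy1 : y ≤ 1) :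
    1 ≤ ErasureDecoder.uncorrectableProb {x : BB.Mono 6 6 ⊕ BB.Mono 6 6 → ZMod 2 | BB.bb72.HX *ᵥ x = 0}
          (BB.bb72.css.rowSpZ : Set (BB.Mono 6 6 ⊕ BB.Mono 6 6 → ZMod 2)) y +
        ErasureDecoder.uncorrectableProb {x : BB.Mono 6 6 ⊕ BB.Mono 6 6 → ZMod 2 | BB.bb72.HZ *ᵥ x = 0}
          (BB.bb72.css.rowSpX : Set (BB.Mono 6 6 ⊕ BB.Mono 6 6 → ZMod 2)) (1 - y) :=
  BB.bb72.css.one_le_uncorrectableProb_add bb72_css_k_pos hy0 hy1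

open Classical in
/-- **`[[72,12,6]]`, independent flips, floor, EVERY pair of decoders**: for `p, p' ≥ 0` with `p + p' = 1/2`,
`1/2 ≤ P^Z_p[D_Z fails] + P^X_{p'}[D_X fails]`. [cite: RichardsonUrbanke2008, Lemma 4.78 (Erasure Decomposition Lemma)] -/
theorem bb72_half_le_failure_add
    (DZ DX : Decoder (BB.Mono 6 6 → ZMod 2) (BB.Mono 6 6 ⊕ BB.Mono 6 6 → ZMod 2))
    {p p' : ℝ} (hp0 : 0 ≤ p) (hp'0 : 0 ≤ p') (hsum : p + p' = 1 / 2) :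
    1 / 2 ≤ (∑ e ∈ univ.filter (fun e : BB.Mono 6 6 ⊕ BB.Mono 6 6 → ZMod 2 =>
          ¬ DZ.Corrects BB.bb72.css.zSyndrome (BB.bb72.css.rowSpZ : Set (BB.Mono 6 6 ⊕ BB.Mono 6 6 → ZMod 2)) e),
          bernoulliWeight p (supp e)) +
      ∑ e ∈ univ.filter (fun e : BB.Mono 6 6 ⊕ BB.Mono 6 6 → ZMod 2 =>
          ¬ DX.Corrects BB.bb72.css.xSyndrome (BB.bb72.css.rowSpX : Set (BB.Mono 6 6 ⊕ BB.Mono 6 6 → ZMod 2)) e),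
          bernoulliWeight p' (supp e) :=
  BB.bb72.css.half_le_zFailure_add_xFailure bb72_css_k_pos DZ DX hp0 hp'0 hsum

/-- **`[[144,12,12]]`, erasures, floor**: `1 ≤ P^Z_y[uncorrectable] + P^X_{1-y}[uncorrectable]`.
[cite: StaceBarrettDoherty2009, p. 2 (no-cloning bound); BravyiTerhal2009, §2 Lemma 1] -/
theorem bb144_one_le_uncorrectableProb_add {y : ℝ} (hy0 : 0 ≤ y) (hy1 : y ≤ 1) :
    1 ≤ ErasureDecoder.uncorrectableProb {x : BB.Mono 12 6 ⊕ BB.Mono 12 6 → ZMod 2 | BB.bb144.HX *ᵥ x = 0}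
          (BB.bb144.css.rowSpZ : Set (BB.Mono 12 6 ⊕ BB.Mono 12 6 → ZMod 2)) y +
        ErasureDecoder.uncorrectableProb {x : BB.Mono 12 6 ⊕ BB.Mono 12 6 → ZMod 2 | BB.bb144.HZ *ᵥ x = 0}
          (BB.bb144.css.rowSpX : Set (BB.Mono 12 6 ⊕ BB.Mono 12 6 → ZMod 2)) (1 - y) :=
  BB.bb144.css.one_le_uncorrectableProb_add bb144_css_k_pos hy0 hy1

open Classical in
/-- **`[[144,12,12]]`, independent flips, floor, EVERY pair of decoders**: `p + p' = 1/2 ⇒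
1/2 ≤ P^Z_p[D_Z fails] + P^X_{p'}[D_X fails]`. [cite: RichardsonUrbanke2008, Lemma 4.78 (Erasure Decomposition Lemma)] -/
theorem bb144_half_le_failure_add
    (DZ DX : Decoder (BB.Mono 12 6 → ZMod 2) (BB.Mono 12 6 ⊕ BB.Mono 12 6 → ZMod 2))
    {p p' : ℝ} (hp0 : 0 ≤ p) (hp'0 : 0 ≤ p') (hsum : p + p' = 1 / 2) :
    1 / 2 ≤ (∑ e ∈ univ.filter (fun e : BB.Mono 12 6 ⊕ BB.Mono 12 6 → ZMod 2 =>
          ¬ DZ.Corrects BB.bb144.css.zSyndrome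
            (BB.bb144.css.rowSpZ : Set (BB.Mono 12 6 ⊕ BB.Mono 12 6 → ZMod 2)) e),
          bernoulliWeight p (supp e)) +
      ∑ e ∈ univ.filter (fun e : BB.Mono 12 6 ⊕ BB.Mono 12 6 → ZMod 2 =>
          ¬ DX.Corrects BB.bb144.css.xSyndrome
            (BB.bb144.css.rowSpX : Set (BB.Mono 12 6 ⊕ BB.Mono 12 6 → ZMod 2)) e),
          bernoulliWeight p' (supp e) :=
  BB.bb144.css.half_le_zFailure_add_xFailure bb144_css_k_pos DZ DX hp0 hp'0 hsum

end BB

end Summit.Ventures.QEC.Thresholds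

end
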